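import Summits.ResolutionOfSingularities.ResolutionOfSingularities.Theorems.AQSHeightTwoPlusStalk
import Summits.ResolutionOfSingularities.ResolutionOfSingularities.Theorems.AQSHeightTwoPlusStalkFactor
import HarnessLib

/-!
# (o25) «F-AQS-T in the kernel», piece (γ2) — PLUS-STALK at the stalk `𝒪_{Y,η}` itself: the (I4)-shaped statement

Route `ResolutionOfSingularities/WeightedInvariant`, crux `Theses.WeightedInvariant.HypersurfaceCentreConstruction`
(stmt-ResolutionOfSingularities-19897), door line `local-engine`, rung `e = 1`, ORDER (o25) of res-L1-w43-plan-1; res-type-092's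
TEAM RECONCILIATION (I4) 2026-08-27T10:17Z fixed the shape in which the `_holds` assembly consumes PLUS-STALK: `S := Y.presheaf.stalk η`,
`x :=` the germs of the chart parameters, game ring `B_S := extReesAlgebra (weightedMonomialIdeal x w)`, and for every `b : B₊(U)` over `η`
a prime `𝔫` of `B_S` with `t⁻¹ ∈ 𝔫`, `𝔪_S B_S ≤ 𝔫`, `𝔫` off the vertex, and a `t⁻¹`-PRIMITIVE factorisation `f = (t⁻¹)ᵃ g` with the
order of the strict transform at `b` read on `g/1 ∈ (B_S)_𝔫`.  This file assembles exactly that from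
`ReesAlgebraData.idealOrder_cobordantStrictTransform_le_adicOrder` (`AQSHeightTwoPlusStalk.lean`, with the local model `A' := 𝒪_{Y,η}`,
`TopCat.Presheaf.algebra_section_stalk` + `IsAffineOpen.isLocalization_stalk`) and the factorisation brick
`exists_tInv_primitive_factorisation_weighted` (`AQSHeightTwoPlusStalkFactor.lean`):

* **`ReesAlgebraData.IsWeightedChart.exists_gameSide_prime_factorisation`** — the (I4) statement with `≤` in the read-off
  (`idealOrder (R.cobordantStrictTransform U X) b ≤ adicOrder (g/1)`; the LOCAL DROP (β2) bounds the right-hand side by `< ν`, which is all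
  clause (5) of `AbramovichQuekSchober2025_heightTwoCentre` consumes), from `f ∉ 𝒥_N(x; w)` for some `N`;
* `…_of_not_mem_pow` — the same from `f ∉ 𝔪_η ^ k` and a weight bound `wᵢ ≤ W`, `0 < W` (`𝒥_{kW} ⊆ 𝔪^k`).

Def-free helper (`--supports stmt-ResolutionOfSingularities-19897`); OURS bookkeeping — nothing here is a claim about resolution of
singularities in positive characteristic or about the cited paper beyond its typed statement.  AI-written; weaker than expert review.
[cite: Wlodarczyk2022, Def. 2.3.5; 3.3.12; Def. 5.1.1]
-/

noncomputable section

set_option linter.dupNamespace false -- mandated namespace of this single-conjunct summit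

open CategoryTheory AlgebraicGeometry TopologicalSpace IsLocalRing
open scoped LaurentPolynomial
open Literature.AlgebraicGeometry.Resolution
open Summit.ResolutionOfSingularities.ResolutionOfSingularities.Theorems

namespace Summit.ResolutionOfSingularities.ResolutionOfSingularities.Theorems.AQSHeightTwo

variable {Y : Scheme.{0}} (R : ReesAlgebraData Y) (U : Y.affineOpens)

/-- **(γ2) PLUS-STALK at `𝒪_{Y,η}` — the (I4) shape.**  Let `(U, u, w)` be a weighted chart of the Rees algebra `R` on `Y`,
`η ∈ U` a point at which the germs `xᵢ` of the `uᵢ` lie in `𝔪_η`, `X` an ideal sheaf with principal stalk `X_η = (f)`, and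
`f ∉ 𝒥_N(x; w) = (x^α : w·α ≥ N)` for some `N`.  Then for every point `b` of `B₊(U)` over `η` there are a prime `𝔫` of the game ring
`B_S = 𝒪_{Y,η}[t⁻¹, 𝒥ₙ(x; w) tⁿ]` containing `t⁻¹` and `𝔪_η B_S`, off the vertex, and a `t⁻¹`-primitive factorisation `f = (t⁻¹)ᵃ g` in
`B_S` (`t⁻¹ ∤ g`), with `idealOrder (R.cobordantStrictTransform U X) b ≤ adicOrder (g/1 ∈ (B_S)_𝔫)`.
[cite: Wlodarczyk2022, Def. 5.1.1; 3.3.12] -/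
theorem _root_.Literature.AlgebraicGeometry.Resolution.ReesAlgebraData.IsWeightedChart.exists_gameSide_prime_factorisation
    {m : ℕ} {u : Fin m → Γ(Y, U)} {w : Fin m → ℕ} (hchart : R.IsWeightedChart U u w)
    {η : Y} (hη : η ∈ (U : Y.Opens)) {x : Fin m → Y.presheaf.stalk η}
    (hx : ∀ i, (Y.presheaf.germ (U : Y.Opens) η hη).hom (u i) = x i)
    (hxm : ∀ i, x i ∈ maximalIdeal (Y.presheaf.stalk η))
    (X : Y.IdealSheafData) {f : Y.presheaf.stalk η} (hf : stalkIdeal X η = Ideal.span {f})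
    {N : ℕ} (hfN : f ∉ weightedMonomialIdeal x w N)
    (b : R.cobordantPlus U) (hb : R.cobordantPlusι U b = η) :
    ∃ (𝔫 : Ideal (extReesAlgebra (weightedMonomialIdeal x w))) (_ : 𝔫.IsPrime),
      extReesAlgebra.tInv (weightedMonomialIdeal x w) ∈ 𝔫 ∧
      (maximalIdeal (Y.presheaf.stalk η)).map
        (algebraMap (Y.presheaf.stalk η) (extReesAlgebra (weightedMonomialIdeal x w))) ≤ 𝔫 ∧
      ¬ extReesAlgebra.vertexIdeal (weightedMonomialIdeal x w) ≤ 𝔫 ∧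
      ∃ (a : ℕ) (g : extReesAlgebra (weightedMonomialIdeal x w)),
        algebraMap (Y.presheaf.stalk η) (extReesAlgebra (weightedMonomialIdeal x w)) f =
          extReesAlgebra.tInv (weightedMonomialIdeal x w) ^ a * g ∧
        ¬ extReesAlgebra.tInv (weightedMonomialIdeal x w) ∣ g ∧
        idealOrder (R.cobordantStrictTransform U X) b ≤
          adicOrder (algebraMap (extReesAlgebra (weightedMonomialIdeal x w)) (Localization.AtPrime 𝔫) g) := by
  -- the local model `A' := 𝒪_{Y,η}` as a localisation of `Γ(Y, U)` at the prime of `η`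
  letI : Algebra Γ(Y, U) (Y.presheaf.stalk η) := Y.presheaf.algebra_section_stalk (⟨η, hη⟩ : (U : Y.Opens))
  haveI : IsLocalization.AtPrime (Y.presheaf.stalk η) (U.2.primeIdealOf ⟨η, hη⟩).asIdeal :=
    U.2.isLocalization_stalk ⟨η, hη⟩
  have halg : algebraMap Γ(Y, U) (Y.presheaf.stalk η) = (Y.presheaf.germ (U : Y.Opens) η hη).hom :=
    TopCat.Presheaf.stalk_open_algebraMap Y.presheaf ⟨η, hη⟩
  -- the localised pieces are the weighted monomial ideals of the germs
  have hI' : ∀ n, weightedMonomialIdeal x w n = (R.chartIdeals U n).map (algebraMap Γ(Y, U) (Y.presheaf.stalk η)) := by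
    intro n
    have hux : (fun i => algebraMap Γ(Y, U) (Y.presheaf.stalk η) (u i)) = x := funext fun i => by rw [halg]; exact hx i
    rw [← hux]
    exact hchart.weightedMonomialIdeal_map_eq R U n
  -- `η` lies in the support of the centre, and `f ∈ X(U) 𝒪_{Y,η} = X_η`
  have hsupp : η ∈ R.support :=
    hchart.mem_support_of_forall_germ_mem R U hη fun i => by rw [hx i]; exact hxm i
  have hfmem : f ∈ (X.ideal U).map (algebraMap Γ(Y, U) (Y.presheaf.stalk η)) := by
    rw [halg, ← stalkIdeal_eq_map_germ X U hη, hf]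
    exact Ideal.mem_span_singleton_self f
  -- the game-side prime with the order read-off, and a primitive factorisation
  have hread0 := R.idealOrder_cobordantStrictTransform_le_adicOrder U (hchart.chartIdeals_antitone R U) b η hη hb hI'
  obtain ⟨𝔫, h𝔫, hV, hM, hT, hread⟩ := hread0
  have hfac0 := exists_tInv_primitive_factorisation_weighted x w hfN
  obtain ⟨a, g, -, -, -, hfg, hndvd⟩ := hfac0
  exact ⟨𝔫, h𝔫, hT hsupp, hM, hV, a, g, hfg, hndvd, hread X f hfmem a g hfg⟩

/-- The same from `f ∉ 𝔪_η ^ k` and a positive bound `W` on the weights (`𝒥_{kW}(x; w) ⊆ 𝔪_η^k`,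
`weightedMonomialIdeal_le_maximalIdeal_pow_div`) — the form the (o25) assembly holds (`f ∉ 𝔪^{ν+1}`, weights `q ≤ r`).
[cite: Wlodarczyk2022, Def. 5.1.1; 3.3.12] -/
theorem _root_.Literature.AlgebraicGeometry.Resolution.ReesAlgebraData.IsWeightedChart.exists_gameSide_prime_factorisation_of_not_mem_pow
    {m : ℕ} {u : Fin m → Γ(Y, U)} {w : Fin m → ℕ} (hchart : R.IsWeightedChart U u w)
    {η : Y} (hη : η ∈ (U : Y.Opens)) {x : Fin m → Y.presheaf.stalk η}
    (hx : ∀ i, (Y.presheaf.germ (U : Y.Opens) η hη).hom (u i) = x i)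
    (hxm : ∀ i, x i ∈ maximalIdeal (Y.presheaf.stalk η))
    (X : Y.IdealSheafData) {f : Y.presheaf.stalk η} (hf : stalkIdeal X η = Ideal.span {f})
    {k : ℕ} (hfk : f ∉ maximalIdeal (Y.presheaf.stalk η) ^ k) {W : ℕ} (hW0 : 0 < W) (hW : ∀ i, w i ≤ W)
    (b : R.cobordantPlus U) (hb : R.cobordantPlusι U b = η) :
    ∃ (𝔫 : Ideal (extReesAlgebra (weightedMonomialIdeal x w))) (_ : 𝔫.IsPrime),
      extReesAlgebra.tInv (weightedMonomialIdeal x w) ∈ 𝔫 ∧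
      (maximalIdeal (Y.presheaf.stalk η)).map
        (algebraMap (Y.presheaf.stalk η) (extReesAlgebra (weightedMonomialIdeal x w))) ≤ 𝔫 ∧
      ¬ extReesAlgebra.vertexIdeal (weightedMonomialIdeal x w) ≤ 𝔫 ∧
      ∃ (a : ℕ) (g : extReesAlgebra (weightedMonomialIdeal x w)),
        algebraMap (Y.presheaf.stalk η) (extReesAlgebra (weightedMonomialIdeal x w)) f =
          extReesAlgebra.tInv (weightedMonomialIdeal x w) ^ a * g ∧
        ¬ extReesAlgebra.tInv (weightedMonomialIdeal x w) ∣ g ∧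
        idealOrder (R.cobordantStrictTransform U X) b ≤
          adicOrder (algebraMap (extReesAlgebra (weightedMonomialIdeal x w)) (Localization.AtPrime 𝔫) g) := by
  have hfN : f ∉ weightedMonomialIdeal x w (k * W) := fun h =>
    hfk (by simpa [Nat.mul_div_cancel k hW0] using weightedMonomialIdeal_le_maximalIdeal_pow_div hxm hW (k * W) h)
  exact hchart.exists_gameSide_prime_factorisation R U hη hx hxm X hf hfN b hb

/-- **Clause (5) from a LOCAL DROP.**  Same data, and `ν : ℕ∞`.  If the local weighted game over `S = 𝒪_{Y,η}` DROPS — every prime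
`𝔫` of `B_S = S[t⁻¹, 𝒥ₙ(x; w) tⁿ]` with `t⁻¹ ∈ 𝔫 ⊇ 𝔪_S B_S`, off the vertex, and every `t⁻¹`-primitive factorisation `f = (t⁻¹)ᵃ g` have
`adicOrder (g/1 ∈ (B_S)_𝔫) < ν` (the shape of the (o25) LOCAL DROP (β2) `adicOrder_transform_lt`) — then the strict transform has
`idealOrder < ν` at EVERY point of `B₊(U)` over `η`: the order clause (5) of `AbramovichQuekSchober2025_heightTwoCentre` on `Y` itself
(`exists_gameSide_prime_factorisation` + the hypothesis). [cite: AbramovichQuekSchober2025, Thm 1.3 (3)] [cite: Wlodarczyk2022, 3.3.12] -/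
theorem _root_.Literature.AlgebraicGeometry.Resolution.ReesAlgebraData.IsWeightedChart.idealOrder_cobordantStrictTransform_lt_of_localDrop
    {m : ℕ} {u : Fin m → Γ(Y, U)} {w : Fin m → ℕ} (hchart : R.IsWeightedChart U u w)
    {η : Y} (hη : η ∈ (U : Y.Opens)) {x : Fin m → Y.presheaf.stalk η}
    (hx : ∀ i, (Y.presheaf.germ (U : Y.Opens) η hη).hom (u i) = x i)
    (hxm : ∀ i, x i ∈ maximalIdeal (Y.presheaf.stalk η))
    (X : Y.IdealSheafData) {f : Y.presheaf.stalk η} (hf : stalkIdeal X η = Ideal.span {f})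
    {N : ℕ} (hfN : f ∉ weightedMonomialIdeal x w N) {ν : ℕ∞}
    (hdrop : ∀ (𝔫 : Ideal (extReesAlgebra (weightedMonomialIdeal x w))) [𝔫.IsPrime],
      extReesAlgebra.tInv (weightedMonomialIdeal x w) ∈ 𝔫 →
      (maximalIdeal (Y.presheaf.stalk η)).map
        (algebraMap (Y.presheaf.stalk η) (extReesAlgebra (weightedMonomialIdeal x w))) ≤ 𝔫 →
      ¬ (extReesAlgebra.vertexIdeal (weightedMonomialIdeal x w) ≤ 𝔫) →
      ∀ (a : ℕ) (g : extReesAlgebra (weightedMonomialIdeal x w)),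
        algebraMap (Y.presheaf.stalk η) (extReesAlgebra (weightedMonomialIdeal x w)) f =
          extReesAlgebra.tInv (weightedMonomialIdeal x w) ^ a * g →
        ¬ (extReesAlgebra.tInv (weightedMonomialIdeal x w) ∣ g) →
        adicOrder (algebraMap (extReesAlgebra (weightedMonomialIdeal x w)) (Localization.AtPrime 𝔫) g) < ν) :
    ∀ b : R.cobordantPlus U, R.cobordantPlusι U b = η → idealOrder (R.cobordantStrictTransform U X) b < ν := by
  intro b hb
  have h := hchart.exists_gameSide_prime_factorisation R U hη hx hxm X hf hfN b hb
  obtain ⟨𝔫, h𝔫, hT, hM, hV, a, g, hfg, hndvd, hle⟩ := h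
  exact lt_of_le_of_lt hle (hdrop 𝔫 hT hM hV a g hfg hndvd)

/-- Clause (5) from a local drop, with the hypothesis `f ∉ 𝔪_η ^ k` and a positive weight bound instead of `f ∉ 𝒥_N`.
[cite: AbramovichQuekSchober2025, Thm 1.3 (3)] [cite: Wlodarczyk2022, 3.3.12] -/
theorem _root_.Literature.AlgebraicGeometry.Resolution.ReesAlgebraData.IsWeightedChart.idealOrder_cobordantStrictTransform_lt_of_localDrop_of_not_mem_pow
    {m : ℕ} {u : Fin m → Γ(Y, U)} {w : Fin m → ℕ} (hchart : R.IsWeightedChart U u w)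
    {η : Y} (hη : η ∈ (U : Y.Opens)) {x : Fin m → Y.presheaf.stalk η}
    (hx : ∀ i, (Y.presheaf.germ (U : Y.Opens) η hη).hom (u i) = x i)
    (hxm : ∀ i, x i ∈ maximalIdeal (Y.presheaf.stalk η))
    (X : Y.IdealSheafData) {f : Y.presheaf.stalk η} (hf : stalkIdeal X η = Ideal.span {f})
    {k : ℕ} (hfk : f ∉ maximalIdeal (Y.presheaf.stalk η) ^ k) {W : ℕ} (hW0 : 0 < W) (hW : ∀ i, w i ≤ W) {ν : ℕ∞}
    (hdrop : ∀ (𝔫 : Ideal (extReesAlgebra (weightedMonomialIdeal x w))) [𝔫.IsPrime],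
      extReesAlgebra.tInv (weightedMonomialIdeal x w) ∈ 𝔫 →
      (maximalIdeal (Y.presheaf.stalk η)).map
        (algebraMap (Y.presheaf.stalk η) (extReesAlgebra (weightedMonomialIdeal x w))) ≤ 𝔫 →
      ¬ (extReesAlgebra.vertexIdeal (weightedMonomialIdeal x w) ≤ 𝔫) →
      ∀ (a : ℕ) (g : extReesAlgebra (weightedMonomialIdeal x w)),
        algebraMap (Y.presheaf.stalk η) (extReesAlgebra (weightedMonomialIdeal x w)) f =
          extReesAlgebra.tInv (weightedMonomialIdeal x w) ^ a * g →
        ¬ (extReesAlgebra.tInv (weightedMonomialIdeal x w) ∣ g) →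
        adicOrder (algebraMap (extReesAlgebra (weightedMonomialIdeal x w)) (Localization.AtPrime 𝔫) g) < ν) :
    ∀ b : R.cobordantPlus U, R.cobordantPlusι U b = η → idealOrder (R.cobordantStrictTransform U X) b < ν := by
  have hfN : f ∉ weightedMonomialIdeal x w (k * W) := fun h =>
    hfk (by simpa [Nat.mul_div_cancel k hW0] using weightedMonomialIdeal_le_maximalIdeal_pow_div hxm hW (k * W) h)
  exact hchart.idealOrder_cobordantStrictTransform_lt_of_localDrop R U hη hx hxm X hf hfN hdrop

end Summit.ResolutionOfSingularities.ResolutionOfSingularities.Theorems.AQSHeightTwo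

end
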